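/-
Copyright (c) 2026 the pub-hodgecm-mathlib formalisation cell (harness21).  Prover seat hodgecm-mathlib-LH4-p12 (g7), req620 Track A «(D-RAM) FOUR-FRAME», line LH4
(STAGE-1b tier-0 regular row, (L-sq) labelled trunk brick (a) of the (T-box | sq) SPEC `F0/P3c/LH4/LH4-p12/g7/tbox/TBOX-SQ-SPEC.v1.LH4p12g7.md`: the ON-LOCUS TRICHOTOMY —
the level label is constant on a glued ∕ core-hanging stratum not only OFF the cancellation locus (★ LH4-p09 `_of_ne`) but also ON it when both mixed summands are already in the
ball; only the case «equal valuations above the threshold» cuts the stratum by class).  2026-09-04.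
-/
import Summits.HodgeConjecture.HodgeConjecture.Theorems.F0P3cDyRamLabelledKappaGluedRotationsOffLocus   -- ★ p859817 (this seat): brings ★ p859714 (G1∕H `_of_ne` sockets), ★ p859787 (rotations), ★ LH4-p09's criteria
import HarnessLib

/-!
# Crux `H413`, line LH4 «(D-RAM) FOUR-FRAME» — (S2b-T) brick (a): THE LABELLED TYPE-0 κ-SOCKETS G1 ∕ G2 ∕ G3 ∕ H OFF THE CLASS CUT (on-locus trichotomy)

On a glued stratum G1 `(2ρ, 2ρ+s, 2ρ+s)` (members `latt(1,0,0; x,ϖ^ρ,0; xζ+y″, ϖ^ρζ, ϖ^{2ρ+s})`, `|x| = |ζ| = 1`, `|y″| = |ϖ|^s`) the level label `diag(e)·M ⊆ ϖ^ℓ·M` is three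
constant conditions plus the MIXED condition `|x·ζ·(e₂ − e₁) + (e₂ − e₀)·y″| ≤ |ϖ|^{ℓ+2ρ+s}` (★ LH4-p09 `latticeInLevel_diagonal_latt_G1_iff`), whose two summands have the
CONSTANT valuations `a = |e₂ − e₁|`, `b = |e₂ − e₀|·|ϖ|^s`.  TRICHOTOMY (ultrametric): `max(a,b) ≤ c` ⇒ the condition HOLDS on the whole stratum; `a ≠ b`, `max(a,b) > c` ⇒ it
FAILS on the whole stratum (these two are «constant = (a ≤ c ∧ b ≤ c)», ★ LH4-p09's `_of_ne` being the sub-case `a ≠ b`); `a = b > c` ⇒ it depends on the class (the CLASS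
CUT, LH4-p09 (g8)'s locus census).  So the label is constant under the single hypothesis `hcut : ¬ (a = b ∧ c < a)`, and the labelled κ-sockets of ★ p859714 ∕ ★ p859817 hold
verbatim under `hcut` in place of `a ≠ b`.  For the (L-sq) label of record the (T-box | sq) SPEC sweep shows: under the in-theorem fence `nᵢ ≥ 2d − 1` NO G-cell is ever cut,
and the only cut cells are equilateral hanging H cells with `m* + 2ρ > 2n` (whose cut is predicted EMPTY).

* §1 `latticeInLevel_diagonal_latt_G1_iff_of_not_cut`, `latticeInLevel_diagonal_latt_H_iff_of_not_cut` — the criteria.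
* §2 `finsum_kappaCount_mul_stabiliserWeight_stratum_{G1,H,G2,G3}_sep_latticeInLevel_of_not_cut` — the four labelled κ-sockets off the class cut.

HONEST LABEL: helper lane (`--supports stmt-HodgeConjecture-24833`), count-neutral; criteria + per-stratum census identities; pays no tier-0 row by itself (T₊∕T₋∕reg OPEN; the
labelled trunk stays OPEN: (b) equilateral-hanging-cut-empty, (c) the truncated box-sum, (d) assembly); HC_CM is proved only modulo the 7 printed citations (2 remaining named
inputs: hLiu418 = stmt-HodgeConjecture-24832, h413 = stmt-HodgeConjecture-24833) until rung 0 closes.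

## References (NEVER `[KR2]`)
* [Kottwitz1986BaseChangeUnits] R. E. Kottwitz, *Base change for unit elements of Hecke algebras*, Compositio Math. 60 (1986), §1 pp. 240–241.
* [Rogawski1990] J. D. Rogawski, *Automorphic Representations of Unitary Groups in Three Variables*, Ann. of Math. Stud. 123 (1990), §4.9 Prop. 4.9.1 (a) p. 55, §4.10 p. 58.
* [LanglandsShelstad1987] R. P. Langlands, D. Shelstad, *On the definition of transfer factors*, Math. Ann. 278 (1987), §3.
* [Serre1980Trees] J.-P. Serre, *Trees*, Springer (1980), Ch. II §1.1.
-/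

set_option autoImplicit false

noncomputable section

namespace Summit.HodgeConjecture.HodgeConjecture.Cruxes.H413.F0P3cDyRamLabelledKappaGluedSocketsNotCut

open Matrix
open Literature.NumberTheory.Automorphic Literature.NumberTheory.Automorphic.HermitianLattice
open Literature.NumberTheory.Automorphic.UnitaryLatticeTree Literature.NumberTheory.Automorphic.UnitaryThreeFourFrame
open Literature.NumberTheory.LocalFields Literature.NumberTheory.LocalFields.WildQuadraticDatum
open Summit.HodgeConjecture.HodgeConjecture.Cruxes.H413.F0P3cDyRamDiagonalTorusDefs
open Summit.HodgeConjecture.HodgeConjecture.Cruxes.H413.F0P3cDyRamDiagonalStrataDefs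
open Summit.HodgeConjecture.HodgeConjecture.Cruxes.H413.F0P3cDyRamDiagonalKappaCountDefs
open Summit.HodgeConjecture.HodgeConjecture.Cruxes.H413.F0P3cDyRamDiagonalGluedStratum (stratum_G1_eq)
open Summit.HodgeConjecture.HodgeConjecture.Cruxes.H413.F0P3cDyRamDiagonalCoreHangingSocket (stratum_H_eq)
open Summit.HodgeConjecture.HodgeConjecture.Cruxes.H413.F0P3cDyRamDiagonalKappaGluedSocket (finsum_kappaCount_mul_stabiliserWeight_hasAxis_G1)
open Summit.HodgeConjecture.HodgeConjecture.Cruxes.H413.F0P3cDyRamDiagonalKappaCoreHangingSocket (finsum_kappaCount_mul_stabiliserWeight_hasAxis_H)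
open Summit.HodgeConjecture.HodgeConjecture.Cruxes.H413.F0P3cDyRamDiagonalKappaGluedRotations (vec3_swap01 vec3_swap02)
open Summit.HodgeConjecture.HodgeConjecture.Cruxes.H413.F0P3cDyRamFourFrameCensusDefs
open Summit.HodgeConjecture.HodgeConjecture.Cruxes.H413.F0P3cDyRamLabelledSplitStrata (finsum_mem_sep_eq_ite_of_forall_iff)
open Summit.HodgeConjecture.HodgeConjecture.Cruxes.H413.F0P3cDyRamLabelledGluedStratumRead (latticeInLevel_diagonal_latt_G1_iff latticeInLevel_diagonal_latt_G1_iff_of_ne)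
open Summit.HodgeConjecture.HodgeConjecture.Cruxes.H413.F0P3cDyRamLabelledKappaStrataPermutation
open scoped Valued WithZero Matrix MatrixGroups

/-! ## §1  The criteria off the class cut -/

section Read

variable {K : Type*} [Field K] [Valued K ℤᵐ⁰]

/-- **THE G1 LEVEL TOKEN OFF THE CLASS CUT**: on `latt(1,0,0; x,ϖ^ρ,0; xζ+y″, ϖ^ρζ, ϖ^{2ρ+s})` with `|x| = |ζ| = 1`, `|y″| = |ϖ|^s`, if NOT (`|e₂ − e₁| = |e₂ − e₀|·|ϖ|^s` AND
`|ϖ|^{ℓ+2ρ+s} < |e₂ − e₁|`) then `diag(e)·M ⊆ ϖ^ℓ·M ↔ (∀ i, |e_i| ≤ |ϖ|^ℓ) ∧ |e₁ − e₀| ≤ |ϖ|^{ℓ+ρ} ∧ |e₂ − e₁| ≤ |ϖ|^{ℓ+ρ+s} ∧ (|e₂ − e₁| ≤ |ϖ|^{ℓ+2ρ+s} ∧ |e₂ − e₀|·|ϖ|^s ≤ |ϖ|^{ℓ+2ρ+s})`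
— ★ `_of_ne` when the valuations differ; when they agree and are `≤` the threshold, the mixed term is `≤ max = that valuation` (ultrametric) and both sides hold.
[cite: Serre1980Trees, II §1.1] [cite: Kottwitz1986BaseChangeUnits, §1 pp. 240–241] -/
theorem latticeInLevel_diagonal_latt_G1_iff_of_not_cut {ϖ : K} (hϖ : ϖ ≠ 0) (ℓ ρ s : ℕ) (e : Fin 3 → K) {x ζ y'' : K} (hx : Valued.v x = 1) (hζ : Valued.v ζ = 1)
    (hy : Valued.v y'' = Valued.v ϖ ^ s)
    (hcut : ¬ (Valued.v (e 2 - e 1) = Valued.v (e 2 - e 0) * Valued.v ϖ ^ s ∧ Valued.v ϖ ^ (ℓ + 2 * ρ + s) < Valued.v (e 2 - e 1))) :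
    LatticeInLevel ϖ ℓ (Matrix.diagonal e) (latt (!![1, 0, 0; x, ϖ ^ ρ, 0; x * ζ + y'', ϖ ^ ρ * ζ, ϖ ^ (2 * ρ + s)] : Matrix (Fin 3) (Fin 3) K)) ↔
      (Valued.v (e 0) ≤ Valued.v ϖ ^ ℓ ∧ Valued.v (e 1) ≤ Valued.v ϖ ^ ℓ ∧ Valued.v (e 2) ≤ Valued.v ϖ ^ ℓ) ∧
        Valued.v (e 1 - e 0) ≤ Valued.v ϖ ^ (ℓ + ρ) ∧ Valued.v (e 2 - e 1) ≤ Valued.v ϖ ^ (ℓ + ρ + s) ∧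
          (Valued.v (e 2 - e 1) ≤ Valued.v ϖ ^ (ℓ + 2 * ρ + s) ∧ Valued.v (e 2 - e 0) * Valued.v ϖ ^ s ≤ Valued.v ϖ ^ (ℓ + 2 * ρ + s)) := by
  by_cases hne : Valued.v (e 2 - e 1) ≠ Valued.v (e 2 - e 0) * Valued.v ϖ ^ s
  · exact latticeInLevel_diagonal_latt_G1_iff_of_ne hϖ ℓ ρ s e hx hζ hy hne
  · have heq : Valued.v (e 2 - e 1) = Valued.v (e 2 - e 0) * Valued.v ϖ ^ s := not_not.1 hne
    have hle : Valued.v (e 2 - e 1) ≤ Valued.v ϖ ^ (ℓ + 2 * ρ + s) := not_lt.1 fun h => hcut ⟨heq, h⟩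
    have h1 : Valued.v (x * ζ * (e 2 - e 1)) = Valued.v (e 2 - e 1) := by rw [map_mul, map_mul, hx, hζ, one_mul, one_mul]
    have h2 : Valued.v ((e 2 - e 0) * y'') = Valued.v (e 2 - e 1) := by rw [map_mul, hy, ← heq]
    rw [latticeInLevel_diagonal_latt_G1_iff hϖ ℓ ρ s e hx hζ y'']
    refine ⟨fun ⟨hC, hA, hB, _⟩ => ⟨hC, hA, hB, hle, by rw [← heq]; exact hle⟩, fun ⟨hC, hA, hB, _⟩ => ⟨hC, hA, hB, ?_⟩⟩
    calc Valued.v (x * ζ * (e 2 - e 1) + (e 2 - e 0) * y'')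
        ≤ max (Valued.v (x * ζ * (e 2 - e 1))) (Valued.v ((e 2 - e 0) * y'')) := Valuation.map_add _ _ _
      _ = Valued.v (e 2 - e 1) := by rw [h1, h2, max_self]
      _ ≤ Valued.v ϖ ^ (ℓ + 2 * ρ + s) := hle

/-- **THE H LEVEL TOKEN OFF THE CLASS CUT** (the G1 read at `s = 0`, `|y″| = 1`): if NOT (`|e₂ − e₁| = |e₂ − e₀|` AND `|ϖ|^{ℓ+2ρ} < |e₂ − e₁|`) then the label is the constant
condition `(∀ i, |e_i| ≤ |ϖ|^ℓ) ∧ |e₁ − e₀| ≤ |ϖ|^{ℓ+ρ} ∧ |e₂ − e₁| ≤ |ϖ|^{ℓ+ρ} ∧ (|e₂ − e₁| ≤ |ϖ|^{ℓ+2ρ} ∧ |e₂ − e₀| ≤ |ϖ|^{ℓ+2ρ})`.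
[cite: Serre1980Trees, II §1.1] [cite: Kottwitz1986BaseChangeUnits, §1 pp. 240–241] -/
theorem latticeInLevel_diagonal_latt_H_iff_of_not_cut {ϖ : K} (hϖ : ϖ ≠ 0) (ℓ ρ : ℕ) (e : Fin 3 → K) {x ζ y'' : K} (hx : Valued.v x = 1) (hζ : Valued.v ζ = 1)
    (hy : Valued.v y'' = 1) (hcut : ¬ (Valued.v (e 2 - e 1) = Valued.v (e 2 - e 0) ∧ Valued.v ϖ ^ (ℓ + 2 * ρ) < Valued.v (e 2 - e 1))) :
    LatticeInLevel ϖ ℓ (Matrix.diagonal e) (latt (!![1, 0, 0; x, ϖ ^ ρ, 0; x * ζ + y'', ϖ ^ ρ * ζ, ϖ ^ (2 * ρ)] : Matrix (Fin 3) (Fin 3) K)) ↔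
      (Valued.v (e 0) ≤ Valued.v ϖ ^ ℓ ∧ Valued.v (e 1) ≤ Valued.v ϖ ^ ℓ ∧ Valued.v (e 2) ≤ Valued.v ϖ ^ ℓ) ∧
        Valued.v (e 1 - e 0) ≤ Valued.v ϖ ^ (ℓ + ρ) ∧ Valued.v (e 2 - e 1) ≤ Valued.v ϖ ^ (ℓ + ρ) ∧
          (Valued.v (e 2 - e 1) ≤ Valued.v ϖ ^ (ℓ + 2 * ρ) ∧ Valued.v (e 2 - e 0) ≤ Valued.v ϖ ^ (ℓ + 2 * ρ)) := by
  have hy' : Valued.v y'' = Valued.v ϖ ^ 0 := by rw [pow_zero, hy]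
  have hcut' : ¬ (Valued.v (e 2 - e 1) = Valued.v (e 2 - e 0) * Valued.v ϖ ^ 0 ∧ Valued.v ϖ ^ (ℓ + 2 * ρ + 0) < Valued.v (e 2 - e 1)) := by
    rwa [pow_zero, mul_one, Nat.add_zero]
  have h := latticeInLevel_diagonal_latt_G1_iff_of_not_cut hϖ ℓ ρ 0 e hx hζ hy' hcut'
  simp only [Nat.add_zero, pow_zero, mul_one] at h
  exact h

end Read

/-! ## §2  The four labelled κ-sockets off the class cut -/

section Sockets

variable {K : Type} [Field K] [Valued K ℤᵐ⁰] [CompleteSpace K] [Fintype 𝓀[K]] {σ : K →+* K} {ϖ : K} {d t : ℕ} {α β : K} {N₀ n₁ n₂ n₃ : ℕ}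
  {T : GL (Fin 3) K}

/-- **LABELLED κ-G1 `(2ρ, 2ρ+s, 2ρ+s)` OFF THE CLASS CUT** (`ρ, s ≥ 1`; glue witness `f₀` of foot 0 as in ★ `finsum_kappaCount_mul_stabiliserWeight_hasAxis_G1`; hypothesis
`hcut`: NOT (`|e₂ − e₁| = |e₂ − e₀|·|ϖ|^s` AND `|ϖ|^{ℓ+2ρ+s} < |e₂ − e₁|`) — i.e. off the cancellation locus OR on it with both mixed summands already inside the ball): the ★ unlabelled κ-G1
closed form behind the constant label indicator `(∀ j, |e_j| ≤ |ϖ|^ℓ) ∧ |e₁ − e₀| ≤ |ϖ|^{ℓ+ρ} ∧ |e₂ − e₁| ≤ |ϖ|^{ℓ+ρ+s} ∧ (|e₂ − e₁| ≤ |ϖ|^{ℓ+2ρ+s} ∧ |e₂ − e₀|·|ϖ|^s ≤ |ϖ|^{ℓ+2ρ+s})`, else `0`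
(§1 + ★ `stratum_G1_eq` + ★ `finsum_mem_sep_eq_ite_of_forall_iff`; supersedes ★ p859714's `_of_ne`). [cite: Kottwitz1986BaseChangeUnits, §1 pp. 240–241]
[cite: Rogawski1990, §4.9 Prop. 4.9.1 (a) p. 55; §4.10 p. 58] [cite: LanglandsShelstad1987, §3] -/
theorem finsum_kappaCount_mul_stabiliserWeight_stratum_G1_sep_latticeInLevel_of_not_cut (hD : IsRamifiedQuadraticDatum σ ϖ d t) (h2 : Valued.v (2 : K) < 1)
    (hE : IsElementDatum σ ϖ N₀ α β n₁ n₂ n₃) (hN₀ : d ≤ N₀) (hT : (T : Matrix (Fin 3) (Fin 3) K) = Matrix.diagonal ![α, β, 1])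
    (ρ s : ℕ) (hρ : 1 ≤ ρ) (hs : 1 ≤ s) (i : Fin 3) (f₀ : K) (hf₀ : σ f₀ = f₀)
    (hglue : 2 ∣ s → n₂ = n₃ → n₁ = n₂ + s → n₂ < 2 * ρ → 2 * ρ - n₂ ≤ n₂ - d + 1 → Valued.v (f₀ + (β - 1) / (α - 1)) ≤ Valued.v ϖ ^ (2 * ρ + s - n₂))
    (ℓ : ℕ) (e : Fin 3 → K)
    (hcut : ¬ (Valued.v (e 2 - e 1) = Valued.v (e 2 - e 0) * Valued.v ϖ ^ s ∧ Valued.v ϖ ^ (ℓ + 2 * ρ + s) < Valued.v (e 2 - e 1))) :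
    ∑ᶠ M ∈ {M | M ∈ stratum σ ϖ T ![2 * ρ, 2 * ρ + s, 2 * ρ + s] ∧ LatticeInLevel ϖ ℓ (Matrix.diagonal e) M},
        (kappaCount σ ϖ 0 i M : ℚ) * stabiliserWeight σ M =
      if ((Valued.v (e 0) ≤ Valued.v ϖ ^ ℓ ∧ Valued.v (e 1) ≤ Valued.v ϖ ^ ℓ ∧ Valued.v (e 2) ≤ Valued.v ϖ ^ ℓ) ∧
          Valued.v (e 1 - e 0) ≤ Valued.v ϖ ^ (ℓ + ρ) ∧ Valued.v (e 2 - e 1) ≤ Valued.v ϖ ^ (ℓ + ρ + s) ∧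
            (Valued.v (e 2 - e 1) ≤ Valued.v ϖ ^ (ℓ + 2 * ρ + s) ∧ Valued.v (e 2 - e 0) * Valued.v ϖ ^ s ≤ Valued.v ϖ ^ (ℓ + 2 * ρ + s))) then
        ((if 2 ∣ s ∧ 2 * ρ ≤ min n₂ n₃ ∧ 2 * ρ + s ≤ n₁ then
            (![(normSign σ (-1 : K) : ℚ) * (Fintype.card 𝓀[K] : ℚ) ^ (2 * ρ + s / 2 - 1) *
                ((if 2 * d ≤ s then (Fintype.card 𝓀[K] : ℚ) - 1 else 0) - (if s + 2 = 2 * d then 1 else 0)), 0, 0] : Fin 3 → ℚ) i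
          else 0) +
        (if 2 ∣ s ∧ n₂ = n₃ ∧ n₁ = n₂ + s ∧ n₂ < 2 * ρ ∧ 2 * ρ - n₂ ≤ n₂ - d + 1 then
            (![if 2 * d ≤ s + 2 * ((2 * ρ - n₂ + 1) / 2) then (normSign σ (-1 : K) : ℚ) * normSign σ (1 + f₀) else 0,
               if d ≤ (2 * ρ - n₂ + 1) / 2 then (normSign σ (-1 : K) : ℚ) * normSign σ f₀ * normSign σ (1 + f₀) else 0,
               if d ≤ (2 * ρ - n₂ + 1) / 2 then (normSign σ f₀ : ℚ) else 0] : Fin 3 → ℚ) i *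
              (Fintype.card 𝓀[K] : ℚ) ^ (2 * ρ + s / 2 - (2 * ρ - n₂ + 1) / 2)
          else 0))
      else 0 := by
  classical
  have hvσ : ∀ a, Valued.v (σ a) = Valued.v a := hD.2.1
  have hϖ : Valued.v ϖ = WithZero.exp (-1 : ℤ) := hD.2.2.1
  have hfix : ∀ x : K, σ x = x → x ≠ 0 → ∃ n : ℤ, Valued.v x = WithZero.exp (2 * n) := hD.2.2.2.1
  have hϖ0 : ϖ ≠ 0 := fun h0 => by rw [h0, map_zero] at hϖ; exact WithZero.coe_ne_zero hϖ.symm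
  rw [finsum_mem_sep_eq_ite_of_forall_iff (stratum σ ϖ T ![2 * ρ, 2 * ρ + s, 2 * ρ + s]) _ _ (fun M hM => by
    rw [stratum_G1_eq hvσ hfix hϖ T hρ hs] at hM
    obtain ⟨x, ζ, y'', hx, hζ, hy, rfl, -, -⟩ := hM
    exact latticeInLevel_diagonal_latt_G1_iff_of_not_cut hϖ0 ℓ ρ s e hx hζ hy hcut),
    finsum_kappaCount_mul_stabiliserWeight_hasAxis_G1 hD h2 hE hN₀ hT ρ s hρ hs i f₀ hf₀ hglue]

/-- **LABELLED κ-H `(2ρ, 2ρ, 2ρ)` OFF THE CLASS CUT** (`ρ ≥ 1`; glue witness `f₀` as in ★ `finsum_kappaCount_mul_stabiliserWeight_hasAxis_H`; `hcut`: NOT (`|e₂ − e₁| = |e₂ − e₀|` AND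
`|ϖ|^{ℓ+2ρ} < |e₂ − e₁|`)): the ★ unlabelled κ-H closed form behind the constant label indicator, else `0` (§1 + ★ `stratum_H_eq`; supersedes ★ p859714's `_of_ne`).  For the (L-sq)
label on an EQUILATERAL datum `(n,n,n)` the excluded case is exactly `m* + 2ρ > 2n` — the hanging cells whose cut the (T-box | sq) SPEC predicts EMPTY.
[cite: Kottwitz1986BaseChangeUnits, §1 pp. 240–241] [cite: Rogawski1990, §4.9 Prop. 4.9.1 (a) p. 55; §4.10 p. 58] [cite: LanglandsShelstad1987, §3] -/
theorem finsum_kappaCount_mul_stabiliserWeight_stratum_H_sep_latticeInLevel_of_not_cut (hD : IsRamifiedQuadraticDatum σ ϖ d t) (h2 : Valued.v (2 : K) < 1)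
    (hE : IsElementDatum σ ϖ N₀ α β n₁ n₂ n₃) (hN₀ : d ≤ N₀) (hT : (T : Matrix (Fin 3) (Fin 3) K) = Matrix.diagonal ![α, β, 1]) (ρ : ℕ) (hρ : 1 ≤ ρ)
    (i : Fin 3) (f₀ : K) (hσf₀ : σ f₀ = f₀)
    (hf₀ : n₁ = n₂ → n₂ = n₃ → n₁ < 2 * ρ → 2 * ρ - n₁ ≤ n₁ - d + 1 → Valued.v (f₀ + (β - 1) / (α - 1)) ≤ Valued.v ϖ ^ (2 * ρ - n₁))
    (ℓ : ℕ) (e : Fin 3 → K)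
    (hcut : ¬ (Valued.v (e 2 - e 1) = Valued.v (e 2 - e 0) ∧ Valued.v ϖ ^ (ℓ + 2 * ρ) < Valued.v (e 2 - e 1))) :
    ∑ᶠ M ∈ {M | M ∈ stratum σ ϖ T ![2 * ρ, 2 * ρ, 2 * ρ] ∧ LatticeInLevel ϖ ℓ (Matrix.diagonal e) M}, (kappaCount σ ϖ 0 i M : ℚ) * stabiliserWeight σ M =
      if ((Valued.v (e 0) ≤ Valued.v ϖ ^ ℓ ∧ Valued.v (e 1) ≤ Valued.v ϖ ^ ℓ ∧ Valued.v (e 2) ≤ Valued.v ϖ ^ ℓ) ∧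
          Valued.v (e 1 - e 0) ≤ Valued.v ϖ ^ (ℓ + ρ) ∧ Valued.v (e 2 - e 1) ≤ Valued.v ϖ ^ (ℓ + ρ) ∧
            (Valued.v (e 2 - e 1) ≤ Valued.v ϖ ^ (ℓ + 2 * ρ) ∧ Valued.v (e 2 - e 0) ≤ Valued.v ϖ ^ (ℓ + 2 * ρ))) then
        (if n₁ = n₂ ∧ n₂ = n₃ ∧ n₁ < 2 * ρ ∧ 2 * ρ - n₁ ≤ n₁ - d + 1 ∧ d ≤ (2 * ρ - n₁ + 1) / 2
          then (((![normSign σ (-(1 + f₀)), normSign σ f₀ * normSign σ (-(1 + f₀)), normSign σ f₀] : Fin 3 → ℤ) i : ℤ) : ℚ) *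
            (Fintype.card 𝓀[K] : ℚ) ^ (2 * ρ - (2 * ρ - n₁ + 1) / 2)
          else 0)
      else 0 := by
  classical
  have hvσ : ∀ a, Valued.v (σ a) = Valued.v a := hD.2.1
  have hϖ : Valued.v ϖ = WithZero.exp (-1 : ℤ) := hD.2.2.1
  have hfix : ∀ x : K, σ x = x → x ≠ 0 → ∃ n : ℤ, Valued.v x = WithZero.exp (2 * n) := hD.2.2.2.1
  have hϖ0 : ϖ ≠ 0 := fun h0 => by rw [h0, map_zero] at hϖ; exact WithZero.coe_ne_zero hϖ.symm
  rw [finsum_mem_sep_eq_ite_of_forall_iff (stratum σ ϖ T ![2 * ρ, 2 * ρ, 2 * ρ]) _ _ (fun M hM => by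
    rw [stratum_H_eq hvσ hfix hϖ T hρ] at hM
    obtain ⟨-, -, x, ζ, y'', hx, hζ, hy, -, rfl⟩ := hM
    exact latticeInLevel_diagonal_latt_H_iff_of_not_cut hϖ0 ℓ ρ e hx hζ hy hcut),
    finsum_kappaCount_mul_stabiliserWeight_hasAxis_H hD h2 hE hN₀ hT ρ hρ i f₀ hσf₀ hf₀]

/-- **LABELLED κ-G2 `(2ρ+s, 2ρ, 2ρ+s)` OFF THE CLASS CUT** (`hcut`: NOT (`|e₂ − e₀| = |e₂ − e₁|·|ϖ|^s` AND `|ϖ|^{ℓ+2ρ+s} < |e₂ − e₀|`); glue witness `f` of foot 1):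
the ★ unlabelled κ-G2 closed form behind the rotated constant label indicator, else `0` — ★ p859787 `…_G2_…_of_G1` ∘ §2's G1 (supersedes ★ p859817's `_of_ne`).
[cite: Kottwitz1986BaseChangeUnits, §1 pp. 240–241] [cite: Rogawski1990, §4.9 Prop. 4.9.1 (a) p. 55; §4.10 p. 58] [cite: LanglandsShelstad1987, §3] -/
theorem finsum_kappaCount_mul_stabiliserWeight_stratum_G2_sep_latticeInLevel_of_not_cut (hD : IsRamifiedQuadraticDatum σ ϖ d t) (h2 : Valued.v (2 : K) < 1)
    (hE : IsElementDatum σ ϖ N₀ α β n₁ n₂ n₃) (hN₀ : d ≤ N₀) (hT : (T : Matrix (Fin 3) (Fin 3) K) = Matrix.diagonal ![α, β, 1])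
    (ρ s : ℕ) (hρ : 1 ≤ ρ) (hs : 1 ≤ s) (i : Fin 3) (f : K) (hf : σ f = f)
    (hglue : 2 ∣ s → n₁ = n₃ → n₂ = n₁ + s → n₁ < 2 * ρ → 2 * ρ - n₁ ≤ n₁ - d + 1 → Valued.v (f + (α - 1) / (β - 1)) ≤ Valued.v ϖ ^ (2 * ρ + s - n₁))
    (ℓ : ℕ) (e : Fin 3 → K)
    (hcut : ¬ (Valued.v (e 2 - e 0) = Valued.v (e 2 - e 1) * Valued.v ϖ ^ s ∧ Valued.v ϖ ^ (ℓ + 2 * ρ + s) < Valued.v (e 2 - e 0))) :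
    ∑ᶠ M ∈ {M | M ∈ stratum σ ϖ T ![2 * ρ + s, 2 * ρ, 2 * ρ + s] ∧ LatticeInLevel ϖ ℓ (Matrix.diagonal e) M},
        (kappaCount σ ϖ 0 i M : ℚ) * stabiliserWeight σ M =
      if ((Valued.v (e 1) ≤ Valued.v ϖ ^ ℓ ∧ Valued.v (e 0) ≤ Valued.v ϖ ^ ℓ ∧ Valued.v (e 2) ≤ Valued.v ϖ ^ ℓ) ∧
          Valued.v (e 0 - e 1) ≤ Valued.v ϖ ^ (ℓ + ρ) ∧ Valued.v (e 2 - e 0) ≤ Valued.v ϖ ^ (ℓ + ρ + s) ∧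
            (Valued.v (e 2 - e 0) ≤ Valued.v ϖ ^ (ℓ + 2 * ρ + s) ∧ Valued.v (e 2 - e 1) * Valued.v ϖ ^ s ≤ Valued.v ϖ ^ (ℓ + 2 * ρ + s))) then
        ((if 2 ∣ s ∧ 2 * ρ ≤ min n₁ n₃ ∧ 2 * ρ + s ≤ n₂ then
            (![0, (normSign σ (-1 : K) : ℚ) * (Fintype.card 𝓀[K] : ℚ) ^ (2 * ρ + s / 2 - 1) *
                ((if 2 * d ≤ s then (Fintype.card 𝓀[K] : ℚ) - 1 else 0) - (if s + 2 = 2 * d then 1 else 0)), 0] : Fin 3 → ℚ) i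
          else 0) +
        (if 2 ∣ s ∧ n₁ = n₃ ∧ n₂ = n₁ + s ∧ n₁ < 2 * ρ ∧ 2 * ρ - n₁ ≤ n₁ - d + 1 then
            (![if d ≤ (2 * ρ - n₁ + 1) / 2 then (normSign σ (-1 : K) : ℚ) * normSign σ f * normSign σ (1 + f) else 0,
               if 2 * d ≤ s + 2 * ((2 * ρ - n₁ + 1) / 2) then (normSign σ (-1 : K) : ℚ) * normSign σ (1 + f) else 0,
               if d ≤ (2 * ρ - n₁ + 1) / 2 then (normSign σ f : ℚ) else 0] : Fin 3 → ℚ) i *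
              (Fintype.card 𝓀[K] : ℚ) ^ (2 * ρ + s / 2 - (2 * ρ - n₁ + 1) / 2)
          else 0))
      else 0 := by
  have key := finsum_kappaCount_mul_stabiliserWeight_stratum_G2_sep_latticeInLevel_of_G1 hE hT ρ s ℓ
    (fun α' β' n₁' n₂' n₃' e' => (2 ∣ s → n₂' = n₃' → n₁' = n₂' + s → n₂' < 2 * ρ → 2 * ρ - n₂' ≤ n₂' - d + 1 →
        Valued.v (f + (β' - 1) / (α' - 1)) ≤ Valued.v ϖ ^ (2 * ρ + s - n₂')) ∧
      ¬ (Valued.v (e' 2 - e' 1) = Valued.v (e' 2 - e' 0) * Valued.v ϖ ^ s ∧ Valued.v ϖ ^ (ℓ + 2 * ρ + s) < Valued.v (e' 2 - e' 1)))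
    (fun _ _ n₁' n₂' n₃' e' j =>
      if ((Valued.v (e' 0) ≤ Valued.v ϖ ^ ℓ ∧ Valued.v (e' 1) ≤ Valued.v ϖ ^ ℓ ∧ Valued.v (e' 2) ≤ Valued.v ϖ ^ ℓ) ∧
          Valued.v (e' 1 - e' 0) ≤ Valued.v ϖ ^ (ℓ + ρ) ∧ Valued.v (e' 2 - e' 1) ≤ Valued.v ϖ ^ (ℓ + ρ + s) ∧
            (Valued.v (e' 2 - e' 1) ≤ Valued.v ϖ ^ (ℓ + 2 * ρ + s) ∧ Valued.v (e' 2 - e' 0) * Valued.v ϖ ^ s ≤ Valued.v ϖ ^ (ℓ + 2 * ρ + s))) then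
        ((if 2 ∣ s ∧ 2 * ρ ≤ min n₂' n₃' ∧ 2 * ρ + s ≤ n₁' then
            (![(normSign σ (-1 : K) : ℚ) * (Fintype.card 𝓀[K] : ℚ) ^ (2 * ρ + s / 2 - 1) *
                ((if 2 * d ≤ s then (Fintype.card 𝓀[K] : ℚ) - 1 else 0) - (if s + 2 = 2 * d then 1 else 0)), 0, 0] : Fin 3 → ℚ) j
          else 0) +
        (if 2 ∣ s ∧ n₂' = n₃' ∧ n₁' = n₂' + s ∧ n₂' < 2 * ρ ∧ 2 * ρ - n₂' ≤ n₂' - d + 1 then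
            (![if 2 * d ≤ s + 2 * ((2 * ρ - n₂' + 1) / 2) then (normSign σ (-1 : K) : ℚ) * normSign σ (1 + f) else 0,
               if d ≤ (2 * ρ - n₂' + 1) / 2 then (normSign σ (-1 : K) : ℚ) * normSign σ f * normSign σ (1 + f) else 0,
               if d ≤ (2 * ρ - n₂' + 1) / 2 then (normSign σ f : ℚ) else 0] : Fin 3 → ℚ) j *
              (Fintype.card 𝓀[K] : ℚ) ^ (2 * ρ + s / 2 - (2 * ρ - n₂' + 1) / 2)
          else 0))
      else 0)
    (fun T' e' hE' hT' hHyp j =>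
      finsum_kappaCount_mul_stabiliserWeight_stratum_G1_sep_latticeInLevel_of_not_cut hD h2 hE' hN₀ hT' ρ s hρ hs j f hf hHyp.1 ℓ e' hHyp.2)
    e ⟨hglue, hcut⟩ i
  rw [key]
  simp only [vec3_swap01, Matrix.cons_val_zero, Matrix.cons_val_one, Matrix.cons_val_two, Matrix.head_cons, Matrix.tail_cons]

/-- **LABELLED κ-G3 `(2ρ+s, 2ρ+s, 2ρ)` OFF THE CLASS CUT** (`hcut`: NOT (`|e₀ − e₁| = |e₀ − e₂|·|ϖ|^s` AND `|ϖ|^{ℓ+2ρ+s} < |e₀ − e₁|`); glue witness `f` of foot 2,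
`(βα⁻¹−1)∕(α⁻¹−1) = (β−α)∕(1−α)`): the ★ unlabelled κ-G3 closed form behind the rotated constant label indicator, else `0` — ★ p859787 `…_G3_…_of_G1` ∘ §2's G1 (supersedes ★
p859817's `_of_ne`). [cite: Kottwitz1986BaseChangeUnits, §1 pp. 240–241] [cite: Rogawski1990, §4.9 Prop. 4.9.1 (a) p. 55; §4.10 p. 58] [cite: LanglandsShelstad1987, §3] -/
theorem finsum_kappaCount_mul_stabiliserWeight_stratum_G3_sep_latticeInLevel_of_not_cut (hD : IsRamifiedQuadraticDatum σ ϖ d t) (h2 : Valued.v (2 : K) < 1)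
    (hE : IsElementDatum σ ϖ N₀ α β n₁ n₂ n₃) (hN₀ : d ≤ N₀) (hT : (T : Matrix (Fin 3) (Fin 3) K) = Matrix.diagonal ![α, β, 1])
    (ρ s : ℕ) (hρ : 1 ≤ ρ) (hs : 1 ≤ s) (i : Fin 3) (f : K) (hf : σ f = f)
    (hglue : 2 ∣ s → n₂ = n₁ → n₃ = n₂ + s → n₂ < 2 * ρ → 2 * ρ - n₂ ≤ n₂ - d + 1 → Valued.v (f + (β - α) / (1 - α)) ≤ Valued.v ϖ ^ (2 * ρ + s - n₂))
    (ℓ : ℕ) (e : Fin 3 → K)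
    (hcut : ¬ (Valued.v (e 0 - e 1) = Valued.v (e 0 - e 2) * Valued.v ϖ ^ s ∧ Valued.v ϖ ^ (ℓ + 2 * ρ + s) < Valued.v (e 0 - e 1))) :
    ∑ᶠ M ∈ {M | M ∈ stratum σ ϖ T ![2 * ρ + s, 2 * ρ + s, 2 * ρ] ∧ LatticeInLevel ϖ ℓ (Matrix.diagonal e) M},
        (kappaCount σ ϖ 0 i M : ℚ) * stabiliserWeight σ M =
      if ((Valued.v (e 2) ≤ Valued.v ϖ ^ ℓ ∧ Valued.v (e 1) ≤ Valued.v ϖ ^ ℓ ∧ Valued.v (e 0) ≤ Valued.v ϖ ^ ℓ) ∧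
          Valued.v (e 1 - e 2) ≤ Valued.v ϖ ^ (ℓ + ρ) ∧ Valued.v (e 0 - e 1) ≤ Valued.v ϖ ^ (ℓ + ρ + s) ∧
            (Valued.v (e 0 - e 1) ≤ Valued.v ϖ ^ (ℓ + 2 * ρ + s) ∧ Valued.v (e 0 - e 2) * Valued.v ϖ ^ s ≤ Valued.v ϖ ^ (ℓ + 2 * ρ + s))) then
        ((if 2 ∣ s ∧ 2 * ρ ≤ min n₂ n₁ ∧ 2 * ρ + s ≤ n₃ then
            (![0, 0, (normSign σ (-1 : K) : ℚ) * (Fintype.card 𝓀[K] : ℚ) ^ (2 * ρ + s / 2 - 1) *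
                ((if 2 * d ≤ s then (Fintype.card 𝓀[K] : ℚ) - 1 else 0) - (if s + 2 = 2 * d then 1 else 0))] : Fin 3 → ℚ) i
          else 0) +
        (if 2 ∣ s ∧ n₂ = n₁ ∧ n₃ = n₂ + s ∧ n₂ < 2 * ρ ∧ 2 * ρ - n₂ ≤ n₂ - d + 1 then
            (![if d ≤ (2 * ρ - n₂ + 1) / 2 then (normSign σ f : ℚ) else 0,
               if d ≤ (2 * ρ - n₂ + 1) / 2 then (normSign σ (-1 : K) : ℚ) * normSign σ f * normSign σ (1 + f) else 0,
               if 2 * d ≤ s + 2 * ((2 * ρ - n₂ + 1) / 2) then (normSign σ (-1 : K) : ℚ) * normSign σ (1 + f) else 0] : Fin 3 → ℚ) i *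
              (Fintype.card 𝓀[K] : ℚ) ^ (2 * ρ + s / 2 - (2 * ρ - n₂ + 1) / 2)
          else 0))
      else 0 := by
  have hvσ : ∀ a, Valued.v (σ a) = Valued.v a := hD.2.1
  -- the glue unit of the rescaled datum: `(βα⁻¹ − 1)∕(α⁻¹ − 1) = (β − α)∕(1 − α)` (as in ★ `…hasAxis_G3`)
  have hα : α * σ α = 1 := hE.1
  have hα0 : α ≠ 0 := fun h => by rw [h, zero_mul] at hα; exact zero_ne_one hα
  have hα1 : α ≠ 1 := hE.2.2.2.1
  have hfrac : (β * α⁻¹ - 1) / (α⁻¹ - 1) = (β - α) / (1 - α) := by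
    have h1α : (1 : K) - α ≠ 0 := sub_ne_zero.2 (Ne.symm hα1)
    have hi : α⁻¹ - 1 = (1 - α) * α⁻¹ := by field_simp
    have hn : β * α⁻¹ - 1 = (β - α) * α⁻¹ := by field_simp
    rw [hi, hn, mul_div_mul_right _ _ (inv_ne_zero hα0)]
  have key := finsum_kappaCount_mul_stabiliserWeight_stratum_G3_sep_latticeInLevel_of_G1 hvσ hE hT ρ s ℓ
    (fun α' β' n₁' n₂' n₃' e' => (2 ∣ s → n₂' = n₃' → n₁' = n₂' + s → n₂' < 2 * ρ → 2 * ρ - n₂' ≤ n₂' - d + 1 →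
        Valued.v (f + (β' - 1) / (α' - 1)) ≤ Valued.v ϖ ^ (2 * ρ + s - n₂')) ∧
      ¬ (Valued.v (e' 2 - e' 1) = Valued.v (e' 2 - e' 0) * Valued.v ϖ ^ s ∧ Valued.v ϖ ^ (ℓ + 2 * ρ + s) < Valued.v (e' 2 - e' 1)))
    (fun _ _ n₁' n₂' n₃' e' j =>
      if ((Valued.v (e' 0) ≤ Valued.v ϖ ^ ℓ ∧ Valued.v (e' 1) ≤ Valued.v ϖ ^ ℓ ∧ Valued.v (e' 2) ≤ Valued.v ϖ ^ ℓ) ∧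
          Valued.v (e' 1 - e' 0) ≤ Valued.v ϖ ^ (ℓ + ρ) ∧ Valued.v (e' 2 - e' 1) ≤ Valued.v ϖ ^ (ℓ + ρ + s) ∧
            (Valued.v (e' 2 - e' 1) ≤ Valued.v ϖ ^ (ℓ + 2 * ρ + s) ∧ Valued.v (e' 2 - e' 0) * Valued.v ϖ ^ s ≤ Valued.v ϖ ^ (ℓ + 2 * ρ + s))) then
        ((if 2 ∣ s ∧ 2 * ρ ≤ min n₂' n₃' ∧ 2 * ρ + s ≤ n₁' then
            (![(normSign σ (-1 : K) : ℚ) * (Fintype.card 𝓀[K] : ℚ) ^ (2 * ρ + s / 2 - 1) *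
                ((if 2 * d ≤ s then (Fintype.card 𝓀[K] : ℚ) - 1 else 0) - (if s + 2 = 2 * d then 1 else 0)), 0, 0] : Fin 3 → ℚ) j
          else 0) +
        (if 2 ∣ s ∧ n₂' = n₃' ∧ n₁' = n₂' + s ∧ n₂' < 2 * ρ ∧ 2 * ρ - n₂' ≤ n₂' - d + 1 then
            (![if 2 * d ≤ s + 2 * ((2 * ρ - n₂' + 1) / 2) then (normSign σ (-1 : K) : ℚ) * normSign σ (1 + f) else 0,
               if d ≤ (2 * ρ - n₂' + 1) / 2 then (normSign σ (-1 : K) : ℚ) * normSign σ f * normSign σ (1 + f) else 0,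
               if d ≤ (2 * ρ - n₂' + 1) / 2 then (normSign σ f : ℚ) else 0] : Fin 3 → ℚ) j *
              (Fintype.card 𝓀[K] : ℚ) ^ (2 * ρ + s / 2 - (2 * ρ - n₂' + 1) / 2)
          else 0))
      else 0)
    (fun T' e' hE' hT' hHyp j =>
      finsum_kappaCount_mul_stabiliserWeight_stratum_G1_sep_latticeInLevel_of_not_cut hD h2 hE' hN₀ hT' ρ s hρ hs j f hf hHyp.1 ℓ e' hHyp.2)
    e ⟨fun h1 h2' h3 h4 h5 => by rw [hfrac]; exact hglue h1 h2' h3 h4 h5, hcut⟩ i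
  rw [key]
  simp only [vec3_swap02, Matrix.cons_val_zero, Matrix.cons_val_one, Matrix.cons_val_two, Matrix.head_cons, Matrix.tail_cons]

end Sockets

end Summit.HodgeConjecture.HodgeConjecture.Cruxes.H413.F0P3cDyRamLabelledKappaGluedSocketsNotCut

end
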